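import Summits.ResolutionOfSingularities.ResolutionOfSingularities.Theorems.UniversalCellsDefs

/-!
# Crux `Universality`, line `birth` — the von Staudt configuration forces its entries

Support file for crux stmt-ResolutionOfSingularities-15234 (`UniversalCells.Universality`), lead seat,
cycle 1: registered stub `stub_configDeductions` (the BACKWARD half of `stub_normalizedEncoding`).

For ANY commutative ring `R` and any matrix `M = [I₃ | F | (columns indexed by Kol N)]` over `R` whose
identity block is the identity (`hI`), whose frame column is `(1,1,1)` (`hF`), whose designated entries
are `1` (`hd`) and on which every `3 × 3` minor imposed by `config N Eadd Emul Eone` vanishes (`hv`),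
every entry of `M` is determined (`dC1 … dQ'`: `C1 = (1:1:0)`, `D1 = (1:0:1)`, `X = (0:−1:1)`,
`Qa_r = (x_j:0:1)`, `H_r = (x_i+x_j:1:1)`, `Qm_r = (x_j:0:1)`, `R_r = (0:−x_j:1)`, `Q'_r = (x_i x_j:0:1)`
with `x_k := M 0 (V_k)`), and the values satisfy the elementary relations (`dAdd`, `dMul`, `dOne`).
Every step is one `3 × 3` determinant evaluation (`det_entrySel_*`, `det_e*_F`, `det_e2_KK`,
`det_KKK`, all `Matrix.det_fin_three`) followed by `linear_combination`; the pivots are `±1` by design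
of the configuration, so no division ever occurs. Membership of each selector family in `config` is
recorded once (`mem_config_*`). Source of the gadgets: von Staudt's algebra of throws as used by
Mnëv 1988 and Lee–Vakil 2012 §3 (here on PARTIAL strata, so only the listed incidences are imposed).
-/

-- single-problem summit: the doubled namespace component `ResolutionOfSingularities` is forced
set_option linter.dupNamespace false

noncomputable section

namespace Summit.ResolutionOfSingularities.ResolutionOfSingularities.Theorems.UniversalCells

namespace NormEnc

open Matrix MvPolynomial

variable {R : Type} [CommRing R] {K : Type}

/-! ### Determinant evaluations for a normalised matrix `[I₃ | 𝟙 | *]` over any commutative ring -/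

section DetEval
variable (M : Matrix (Fin 3) (Fin 3 ⊕ (Unit ⊕ K)) R)
  (hI : ∀ i j, M i (Sum.inl j) = (1 : Matrix (Fin 3) (Fin 3) R) i j)
  (hF : ∀ i, M i (Sum.inr (Sum.inl ())) = 1)
include hI

/-- The entry selector at row `0` picks out the entry: `det(e₁, e₂, v) = v₀`. [folklore] -/
lemma det_entrySel_zero (c : Unit ⊕ K) :
    (M.submatrix id (entrySel (Unit ⊕ K) 0 c)).det = M 0 (Sum.inr c) := by
  simp [Matrix.det_fin_three, hI, Fin.succAbove]

/-- `det(e₀, e₂, v) = -v₁`. [folklore] -/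
lemma det_entrySel_one (c : Unit ⊕ K) :
    (M.submatrix id (entrySel (Unit ⊕ K) 1 c)).det = - M 1 (Sum.inr c) := by
  simp [Matrix.det_fin_three, hI, Fin.succAbove]

/-- `det(e₀, e₁, v) = v₂`. [folklore] -/
lemma det_entrySel_two (c : Unit ⊕ K) :
    (M.submatrix id (entrySel (Unit ⊕ K) 2 c)).det = M 2 (Sum.inr c) := by
  simp [Matrix.det_fin_three, hI, Fin.succAbove]

include hF

/-- `det(e₂, F, v) = v₁ - v₀` for the frame column `F = (1,1,1)`. [folklore] -/
lemma det_e2_F (c : K) :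
    (M.submatrix id ![Sum.inl 2, Sum.inr (Sum.inl ()), Sum.inr (Sum.inr c)]).det =
      M 1 (Sum.inr (Sum.inr c)) - M 0 (Sum.inr (Sum.inr c)) := by
  simp [Matrix.det_fin_three, hI, hF]

/-- `det(e₁, F, v) = v₀ - v₂`. [folklore] -/
lemma det_e1_F (c : K) :
    (M.submatrix id ![Sum.inl 1, Sum.inr (Sum.inl ()), Sum.inr (Sum.inr c)]).det =
      M 0 (Sum.inr (Sum.inr c)) - M 2 (Sum.inr (Sum.inr c)) := by
  simp [Matrix.det_fin_three, hI, hF]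
  ring

/-- `det(e₀, F, v) = v₂ - v₁`. [folklore] -/
lemma det_e0_F (c : K) :
    (M.submatrix id ![Sum.inl 0, Sum.inr (Sum.inl ()), Sum.inr (Sum.inr c)]).det =
      M 2 (Sum.inr (Sum.inr c)) - M 1 (Sum.inr (Sum.inr c)) := by
  simp [Matrix.det_fin_three, hI, hF]


omit hF in
/-- `det(e₂, a, b) = a₀ b₁ - a₁ b₀` for two non-identity columns. [folklore] -/
lemma det_e2_KK (a b : K) :
    (M.submatrix id ![Sum.inl 2, Sum.inr (Sum.inr a), Sum.inr (Sum.inr b)]).det =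
      M 0 (Sum.inr (Sum.inr a)) * M 1 (Sum.inr (Sum.inr b)) -
        M 1 (Sum.inr (Sum.inr a)) * M 0 (Sum.inr (Sum.inr b)) := by
  simp [Matrix.det_fin_three, hI]
  ring

omit hI hF in
/-- The rule of Sarrus for three non-identity columns. [folklore] -/
lemma det_KKK (a b c : K) :
    (M.submatrix id ![Sum.inr (Sum.inr a), Sum.inr (Sum.inr b), Sum.inr (Sum.inr c)]).det =
      M 0 (Sum.inr (Sum.inr a)) * M 1 (Sum.inr (Sum.inr b)) * M 2 (Sum.inr (Sum.inr c))
      - M 0 (Sum.inr (Sum.inr a)) * M 2 (Sum.inr (Sum.inr b)) * M 1 (Sum.inr (Sum.inr c))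
      - M 1 (Sum.inr (Sum.inr a)) * M 0 (Sum.inr (Sum.inr b)) * M 2 (Sum.inr (Sum.inr c))
      + M 1 (Sum.inr (Sum.inr a)) * M 2 (Sum.inr (Sum.inr b)) * M 0 (Sum.inr (Sum.inr c))
      + M 2 (Sum.inr (Sum.inr a)) * M 0 (Sum.inr (Sum.inr b)) * M 1 (Sum.inr (Sum.inr c))
      - M 2 (Sum.inr (Sum.inr a)) * M 1 (Sum.inr (Sum.inr b)) * M 0 (Sum.inr (Sum.inr c)) := by
  simp [Matrix.det_fin_three]
  ring

end DetEval


/-! ### Membership of the individual selector families in `config` -/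

section Mem
variable (N : ℕ) (Eadd Emul : Finset (Fin N × Fin N × Fin N)) (Eone : Finset (Fin N))
/-- The selector `entrySel _ 2 (Sum.inr (Sum.inl 0))` belongs to `config`. -/
lemma mem_config_C1_entry :
    (entrySel _ 2 (Sum.inr (Sum.inl 0)) : Fin 3 → Fin 3 ⊕ (Unit ⊕ Kol N)) ∈ config N Eadd Emul Eone :=
  Set.mem_union_left _ (Set.mem_union_left _ (Set.mem_union_left _ (Set.mem_union_left _ (Set.mem_union_left _ (Set.mem_union_left _ (Set.mem_union_left _ (Set.mem_union_left _ (Set.mem_union_left _ (Set.mem_union_left _ (Set.mem_union_left _ (Set.mem_union_left _ (Set.mem_union_left _ (Set.mem_union_left _ (by simp))))))))))))))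
/-- The selector `![colE N 2, colF N, colC1 N]` belongs to `config`. -/
lemma mem_config_C1_det :
    (![colE N 2, colF N, colC1 N] : Fin 3 → Fin 3 ⊕ (Unit ⊕ Kol N)) ∈ config N Eadd Emul Eone :=
  Set.mem_union_left _ (Set.mem_union_left _ (Set.mem_union_left _ (Set.mem_union_left _ (Set.mem_union_left _ (Set.mem_union_left _ (Set.mem_union_left _ (Set.mem_union_left _ (Set.mem_union_left _ (Set.mem_union_left _ (Set.mem_union_left _ (Set.mem_union_left _ (Set.mem_union_left _ (Set.mem_union_left _ (by simp))))))))))))))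
/-- The selector `entrySel _ 1 (Sum.inr (Sum.inl 1))` belongs to `config`. -/
lemma mem_config_D1_entry :
    (entrySel _ 1 (Sum.inr (Sum.inl 1)) : Fin 3 → Fin 3 ⊕ (Unit ⊕ Kol N)) ∈ config N Eadd Emul Eone :=
  Set.mem_union_left _ (Set.mem_union_left _ (Set.mem_union_left _ (Set.mem_union_left _ (Set.mem_union_left _ (Set.mem_union_left _ (Set.mem_union_left _ (Set.mem_union_left _ (Set.mem_union_left _ (Set.mem_union_left _ (Set.mem_union_left _ (Set.mem_union_left _ (Set.mem_union_left _ (Set.mem_union_left _ (by simp))))))))))))))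
/-- The selector `![colE N 1, colF N, colD1 N]` belongs to `config`. -/
lemma mem_config_D1_det :
    (![colE N 1, colF N, colD1 N] : Fin 3 → Fin 3 ⊕ (Unit ⊕ Kol N)) ∈ config N Eadd Emul Eone :=
  Set.mem_union_left _ (Set.mem_union_left _ (Set.mem_union_left _ (Set.mem_union_left _ (Set.mem_union_left _ (Set.mem_union_left _ (Set.mem_union_left _ (Set.mem_union_left _ (Set.mem_union_left _ (Set.mem_union_left _ (Set.mem_union_left _ (Set.mem_union_left _ (Set.mem_union_left _ (Set.mem_union_left _ (by simp))))))))))))))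
/-- The selector `entrySel _ 0 (Sum.inr (Sum.inl 2))` belongs to `config`. -/
lemma mem_config_X_entry :
    (entrySel _ 0 (Sum.inr (Sum.inl 2)) : Fin 3 → Fin 3 ⊕ (Unit ⊕ Kol N)) ∈ config N Eadd Emul Eone :=
  Set.mem_union_left _ (Set.mem_union_left _ (Set.mem_union_left _ (Set.mem_union_left _ (Set.mem_union_left _ (Set.mem_union_left _ (Set.mem_union_left _ (Set.mem_union_left _ (Set.mem_union_left _ (Set.mem_union_left _ (Set.mem_union_left _ (Set.mem_union_left _ (Set.mem_union_left _ (Set.mem_union_left _ (by simp))))))))))))))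
/-- The selector `![colC1 N, colX N, colD1 N]` belongs to `config`. -/
lemma mem_config_X_det :
    (![colC1 N, colX N, colD1 N] : Fin 3 → Fin 3 ⊕ (Unit ⊕ Kol N)) ∈ config N Eadd Emul Eone :=
  Set.mem_union_left _ (Set.mem_union_left _ (Set.mem_union_left _ (Set.mem_union_left _ (Set.mem_union_left _ (Set.mem_union_left _ (Set.mem_union_left _ (Set.mem_union_left _ (Set.mem_union_left _ (Set.mem_union_left _ (Set.mem_union_left _ (Set.mem_union_left _ (Set.mem_union_left _ (Set.mem_union_left _ (by simp))))))))))))))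
/-- The selectors `entrySel _ 2 (Sum.inr (Sum.inr (Sum.inl i)))` belong to `config`. -/
lemma mem_config_V_entry (i : Fin N) :
    (entrySel _ 2 (Sum.inr (Sum.inr (Sum.inl i))) : Fin 3 → Fin 3 ⊕ (Unit ⊕ Kol N)) ∈ config N Eadd Emul Eone :=
  Set.mem_union_left _ (Set.mem_union_left _ (Set.mem_union_left _ (Set.mem_union_left _ (Set.mem_union_left _ (Set.mem_union_left _ (Set.mem_union_left _ (Set.mem_union_left _ (Set.mem_union_left _ (Set.mem_union_left _ (Set.mem_union_left _ (Set.mem_union_left _ (Set.mem_union_left _ (Set.mem_union_right _ (Set.mem_range_self _))))))))))))))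
/-- The selectors `![colE N 2, colF N, colV N i]` belong to `config`. -/
lemma mem_config_one_det (i : Fin N) (hi : i ∈ Eone) :
    (![colE N 2, colF N, colV N i] : Fin 3 → Fin 3 ⊕ (Unit ⊕ Kol N)) ∈ config N Eadd Emul Eone :=
  Set.mem_union_left _ (Set.mem_union_left _ (Set.mem_union_left _ (Set.mem_union_left _ (Set.mem_union_left _ (Set.mem_union_left _ (Set.mem_union_left _ (Set.mem_union_left _ (Set.mem_union_left _ (Set.mem_union_left _ (Set.mem_union_left _ (Set.mem_union_left _ (Set.mem_union_right _ (Set.mem_image_of_mem _ (Finset.mem_coe.mpr hi))))))))))))))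
/-- The selectors `entrySel _ 1 (Sum.inr (Sum.inr (Sum.inr (Sum.inl (r, 0)))))` belong to `config`. -/
lemma mem_config_Qa_entry (r : Fin N × Fin N × Fin N) :
    (entrySel _ 1 (Sum.inr (Sum.inr (Sum.inr (Sum.inl (r, 0))))) : Fin 3 → Fin 3 ⊕ (Unit ⊕ Kol N)) ∈ config N Eadd Emul Eone :=
  Set.mem_union_left _ (Set.mem_union_left _ (Set.mem_union_left _ (Set.mem_union_left _ (Set.mem_union_left _ (Set.mem_union_left _ (Set.mem_union_left _ (Set.mem_union_left _ (Set.mem_union_left _ (Set.mem_union_left _ (Set.mem_union_left _ (Set.mem_union_right _ (Set.mem_range_self _))))))))))))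
/-- The selectors `![colX N, colV N r.2.1, colA N r 0]` belong to `config`. -/
lemma mem_config_Qa_det (r : Fin N × Fin N × Fin N) :
    (![colX N, colV N r.2.1, colA N r 0] : Fin 3 → Fin 3 ⊕ (Unit ⊕ Kol N)) ∈ config N Eadd Emul Eone :=
  Set.mem_union_left _ (Set.mem_union_left _ (Set.mem_union_left _ (Set.mem_union_left _ (Set.mem_union_left _ (Set.mem_union_left _ (Set.mem_union_left _ (Set.mem_union_left _ (Set.mem_union_left _ (Set.mem_union_left _ (Set.mem_union_right _ (Set.mem_range_self _)))))))))))
/-- The selectors `![colE N 0, colF N, colA N r 1]` belong to `config`. -/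
lemma mem_config_H_det3 (r : Fin N × Fin N × Fin N) :
    (![colE N 0, colF N, colA N r 1] : Fin 3 → Fin 3 ⊕ (Unit ⊕ Kol N)) ∈ config N Eadd Emul Eone :=
  Set.mem_union_left _ (Set.mem_union_left _ (Set.mem_union_left _ (Set.mem_union_left _ (Set.mem_union_left _ (Set.mem_union_left _ (Set.mem_union_left _ (Set.mem_union_left _ (Set.mem_union_left _ (Set.mem_union_right _ (Set.mem_range_self _))))))))))
/-- The selectors `![colV N r.1, colA N r 0, colA N r 1]` belong to `config`. -/
lemma mem_config_H_det (r : Fin N × Fin N × Fin N) :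
    (![colV N r.1, colA N r 0, colA N r 1] : Fin 3 → Fin 3 ⊕ (Unit ⊕ Kol N)) ∈ config N Eadd Emul Eone :=
  Set.mem_union_left _ (Set.mem_union_left _ (Set.mem_union_left _ (Set.mem_union_left _ (Set.mem_union_left _ (Set.mem_union_left _ (Set.mem_union_left _ (Set.mem_union_left _ (Set.mem_union_right _ (Set.mem_range_self _)))))))))
/-- The selectors `![colE N 2, colV N r.2.2, colA N r 1]` belong to `config`. -/
lemma mem_config_add_det (r : Fin N × Fin N × Fin N) (hr : r ∈ Eadd) :
    (![colE N 2, colV N r.2.2, colA N r 1] : Fin 3 → Fin 3 ⊕ (Unit ⊕ Kol N)) ∈ config N Eadd Emul Eone :=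
  Set.mem_union_left _ (Set.mem_union_left _ (Set.mem_union_left _ (Set.mem_union_left _ (Set.mem_union_left _ (Set.mem_union_left _ (Set.mem_union_left _ (Set.mem_union_right _ (Set.mem_image_of_mem _ (Finset.mem_coe.mpr hr)))))))))
/-- The selectors `entrySel _ 1 (Sum.inr (Sum.inr (Sum.inr (Sum.inr (r, 0)))))` belong to `config`. -/
lemma mem_config_Qm_entry (r : Fin N × Fin N × Fin N) :
    (entrySel _ 1 (Sum.inr (Sum.inr (Sum.inr (Sum.inr (r, 0))))) : Fin 3 → Fin 3 ⊕ (Unit ⊕ Kol N)) ∈ config N Eadd Emul Eone :=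
  Set.mem_union_left _ (Set.mem_union_left _ (Set.mem_union_left _ (Set.mem_union_left _ (Set.mem_union_left _ (Set.mem_union_left _ (Set.mem_union_right _ (Set.mem_range_self _)))))))
/-- The selectors `![colX N, colV N r.2.1, colM N r 0]` belong to `config`. -/
lemma mem_config_Qm_det (r : Fin N × Fin N × Fin N) :
    (![colX N, colV N r.2.1, colM N r 0] : Fin 3 → Fin 3 ⊕ (Unit ⊕ Kol N)) ∈ config N Eadd Emul Eone :=
  Set.mem_union_left _ (Set.mem_union_left _ (Set.mem_union_left _ (Set.mem_union_left _ (Set.mem_union_left _ (Set.mem_union_right _ (Set.mem_range_self _))))))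
/-- The selectors `entrySel _ 0 (Sum.inr (Sum.inr (Sum.inr (Sum.inr (r, 1)))))` belong to `config`. -/
lemma mem_config_R_entry (r : Fin N × Fin N × Fin N) :
    (entrySel _ 0 (Sum.inr (Sum.inr (Sum.inr (Sum.inr (r, 1))))) : Fin 3 → Fin 3 ⊕ (Unit ⊕ Kol N)) ∈ config N Eadd Emul Eone :=
  Set.mem_union_left _ (Set.mem_union_left _ (Set.mem_union_left _ (Set.mem_union_left _ (Set.mem_union_right _ (Set.mem_range_self _)))))
/-- The selectors `![colC1 N, colM N r 1, colM N r 0]` belong to `config`. -/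
lemma mem_config_R_det (r : Fin N × Fin N × Fin N) :
    (![colC1 N, colM N r 1, colM N r 0] : Fin 3 → Fin 3 ⊕ (Unit ⊕ Kol N)) ∈ config N Eadd Emul Eone :=
  Set.mem_union_left _ (Set.mem_union_left _ (Set.mem_union_left _ (Set.mem_union_right _ (Set.mem_range_self _))))
/-- The selectors `entrySel _ 1 (Sum.inr (Sum.inr (Sum.inr (Sum.inr (r, 2)))))` belong to `config`. -/
lemma mem_config_Qp_entry (r : Fin N × Fin N × Fin N) :
    (entrySel _ 1 (Sum.inr (Sum.inr (Sum.inr (Sum.inr (r, 2))))) : Fin 3 → Fin 3 ⊕ (Unit ⊕ Kol N)) ∈ config N Eadd Emul Eone :=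
  Set.mem_union_left _ (Set.mem_union_left _ (Set.mem_union_right _ (Set.mem_range_self _)))
/-- The selectors `![colV N r.1, colM N r 1, colM N r 2]` belong to `config`. -/
lemma mem_config_Qp_det (r : Fin N × Fin N × Fin N) :
    (![colV N r.1, colM N r 1, colM N r 2] : Fin 3 → Fin 3 ⊕ (Unit ⊕ Kol N)) ∈ config N Eadd Emul Eone :=
  Set.mem_union_left _ (Set.mem_union_right _ (Set.mem_range_self _))
/-- The selectors `![colX N, colV N r.2.2, colM N r 2]` belong to `config`. -/
lemma mem_config_mul_det (r : Fin N × Fin N × Fin N) (hr : r ∈ Emul) :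
    (![colX N, colV N r.2.2, colM N r 2] : Fin 3 → Fin 3 ⊕ (Unit ⊕ Kol N)) ∈ config N Eadd Emul Eone :=
  Set.mem_union_right _ (Set.mem_image_of_mem _ (Finset.mem_coe.mpr hr))

end Mem

/-! ### The deductions: every entry of a normalised configuration matrix is forced -/

section Deduce
variable {N : ℕ} {Eadd Emul : Finset (Fin N × Fin N × Fin N)} {Eone : Finset (Fin N)}
variable {M : Matrix (Fin 3) (Fin 3 ⊕ (Unit ⊕ Kol N)) R}
  (hI : ∀ i j, M i (Sum.inl j) = (1 : Matrix (Fin 3) (Fin 3) R) i j)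
  (hF : ∀ i, M i (Sum.inr (Sum.inl ())) = 1)
  (hd : ∀ c : Kol N, M (dRow N c) (Sum.inr (Sum.inr c)) = 1)
  (hv : ∀ u ∈ config N Eadd Emul Eone, (M.submatrix id u).det = 0)
include hI hF hd hv

/-- Column `C1 = (1 : 1 : 0)`. -/
lemma dC1 : M 2 (colC1 N) = 0 ∧ M 0 (colC1 N) = 1 := by
  have h1 := hv _ (mem_config_C1_entry N Eadd Emul Eone)
  have h2 := hv _ (mem_config_C1_det N Eadd Emul Eone)
  rw [det_entrySel_two M hI] at h1
  rw [det_e2_F M hI hF] at h2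
  have hd1 : M 1 (colC1 N) = 1 := hd (Sum.inl 0)
  exact ⟨h1, by linear_combination hd1 - h2⟩

/-- Column `D1 = (1 : 0 : 1)`. -/
lemma dD1 : M 1 (colD1 N) = 0 ∧ M 0 (colD1 N) = 1 := by
  have h1 := hv _ (mem_config_D1_entry N Eadd Emul Eone)
  have h2 := hv _ (mem_config_D1_det N Eadd Emul Eone)
  rw [det_entrySel_one M hI] at h1
  rw [det_e1_F M hI hF] at h2
  have hd1 : M 2 (colD1 N) = 1 := hd (Sum.inl 1)
  exact ⟨by linear_combination -h1, by linear_combination h2 + hd1⟩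

/-- Column `X = (0 : -1 : 1)`. -/
lemma dX : M 0 (colX N) = 0 ∧ M 1 (colX N) = -1 := by
  have h1 := hv _ (mem_config_X_entry N Eadd Emul Eone)
  have h2 := hv _ (mem_config_X_det N Eadd Emul Eone)
  rw [det_entrySel_zero M hI] at h1
  rw [det_KKK M] at h2
  obtain ⟨c2, c0⟩ := dC1 hI hF hd hv
  obtain ⟨d1, d0⟩ := dD1 hI hF hd hv
  have c1 : M 1 (colC1 N) = 1 := hd (Sum.inl 0)
  have d2 : M 2 (colD1 N) = 1 := hd (Sum.inl 1)
  have x2 : M 2 (colX N) = 1 := hd (Sum.inl 2)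
  refine ⟨h1, ?_⟩
  rw [c0, c1, c2, d0, d1, d2, h1, x2] at h2
  linear_combination h2

omit hF hd in
/-- Value column `V_i = (x_i : 1 : 0)`: its last entry vanishes. -/
lemma dV (i : Fin N) : M 2 (colV N i) = 0 := by
  have h1 := hv _ (mem_config_V_entry N Eadd Emul Eone i)
  rwa [det_entrySel_two M hI] at h1

/-- Addition gadget, column `Qa_r = (x_j : 0 : 1)`. -/
lemma dQa (r : Fin N × Fin N × Fin N) :
    M 1 (colA N r 0) = 0 ∧ M 0 (colA N r 0) = M 0 (colV N r.2.1) := by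
  have h1 := hv _ (mem_config_Qa_entry N Eadd Emul Eone r)
  have h2 := hv _ (mem_config_Qa_det N Eadd Emul Eone r)
  rw [det_entrySel_one M hI] at h1
  rw [det_KKK M] at h2
  obtain ⟨x0, x1⟩ := dX hI hF hd hv
  have x2 : M 2 (colX N) = 1 := hd (Sum.inl 2)
  have v1 : M 1 (colV N r.2.1) = 1 := hd (Sum.inr (Sum.inl r.2.1))
  have v2 := dV hI hv r.2.1
  have q2 : M 2 (colA N r 0) = 1 := hd (Sum.inr (Sum.inr (Sum.inl (r, 0))))
  have q1 : M 1 (colA N r 0) = 0 := by linear_combination -h1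
  refine ⟨q1, ?_⟩
  rw [x0, x1, x2, v1, v2, q1, q2] at h2
  linear_combination -h2

/-- Addition gadget, column `H_r = (x_i + x_j : 1 : 1)`. -/
lemma dH (r : Fin N × Fin N × Fin N) :
    M 2 (colA N r 1) = 1 ∧ M 0 (colA N r 1) = M 0 (colV N r.1) + M 0 (colV N r.2.1) := by
  have h1 := hv _ (mem_config_H_det3 N Eadd Emul Eone r)
  have h2 := hv _ (mem_config_H_det N Eadd Emul Eone r)
  rw [det_e0_F M hI hF] at h1
  rw [det_KKK M] at h2
  obtain ⟨q1, q0⟩ := dQa hI hF hd hv r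
  have q2 : M 2 (colA N r 0) = 1 := hd (Sum.inr (Sum.inr (Sum.inl (r, 0))))
  have v1 : M 1 (colV N r.1) = 1 := hd (Sum.inr (Sum.inl r.1))
  have v2 := dV hI hv r.1
  have hh1 : M 1 (colA N r 1) = 1 := hd (Sum.inr (Sum.inr (Sum.inl (r, 1))))
  have hh2 : M 2 (colA N r 1) = 1 := by linear_combination h1 + hh1
  refine ⟨hh2, ?_⟩
  rw [q0, q1, q2, v1, v2, hh1, hh2] at h2
  linear_combination h2

/-- Addition gadget, final incidence: `x_i + x_j = x_k` for `(i, j, k) ∈ Eadd`. -/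
lemma dAdd (r : Fin N × Fin N × Fin N) (hr : r ∈ Eadd) :
    M 0 (colV N r.1) + M 0 (colV N r.2.1) - M 0 (colV N r.2.2) = 0 := by
  have h := hv _ (mem_config_add_det N Eadd Emul Eone r hr)
  rw [det_e2_KK M hI] at h
  obtain ⟨_, hh0⟩ := dH hI hF hd hv r
  have hh1 : M 1 (colA N r 1) = 1 := hd (Sum.inr (Sum.inr (Sum.inl (r, 1))))
  have v1 : M 1 (colV N r.2.2) = 1 := hd (Sum.inr (Sum.inl r.2.2))
  rw [hh0, hh1, v1] at h
  linear_combination -h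

/-- Multiplication gadget, column `Qm_r = (x_j : 0 : 1)`. -/
lemma dQm (r : Fin N × Fin N × Fin N) :
    M 1 (colM N r 0) = 0 ∧ M 0 (colM N r 0) = M 0 (colV N r.2.1) := by
  have h1 := hv _ (mem_config_Qm_entry N Eadd Emul Eone r)
  have h2 := hv _ (mem_config_Qm_det N Eadd Emul Eone r)
  rw [det_entrySel_one M hI] at h1
  rw [det_KKK M] at h2
  obtain ⟨x0, x1⟩ := dX hI hF hd hv
  have x2 : M 2 (colX N) = 1 := hd (Sum.inl 2)
  have v1 : M 1 (colV N r.2.1) = 1 := hd (Sum.inr (Sum.inl r.2.1))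
  have v2 := dV hI hv r.2.1
  have q2 : M 2 (colM N r 0) = 1 := hd (Sum.inr (Sum.inr (Sum.inr (r, 0))))
  have q1 : M 1 (colM N r 0) = 0 := by linear_combination -h1
  refine ⟨q1, ?_⟩
  rw [x0, x1, x2, v1, v2, q1, q2] at h2
  linear_combination -h2

/-- Multiplication gadget, column `R_r = (0 : -x_j : 1)`. -/
lemma dR (r : Fin N × Fin N × Fin N) :
    M 0 (colM N r 1) = 0 ∧ M 1 (colM N r 1) = - M 0 (colV N r.2.1) := by
  have h1 := hv _ (mem_config_R_entry N Eadd Emul Eone r)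
  have h2 := hv _ (mem_config_R_det N Eadd Emul Eone r)
  rw [det_entrySel_zero M hI] at h1
  rw [det_KKK M] at h2
  obtain ⟨c2, c0⟩ := dC1 hI hF hd hv
  have c1 : M 1 (colC1 N) = 1 := hd (Sum.inl 0)
  obtain ⟨q1, q0⟩ := dQm hI hF hd hv r
  have q2 : M 2 (colM N r 0) = 1 := hd (Sum.inr (Sum.inr (Sum.inr (r, 0))))
  have r2 : M 2 (colM N r 1) = 1 := hd (Sum.inr (Sum.inr (Sum.inr (r, 1))))
  refine ⟨h1, ?_⟩
  rw [c0, c1, c2, q0, q1, q2, h1, r2] at h2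
  linear_combination h2

/-- Multiplication gadget, column `Q'_r = (x_i x_j : 0 : 1)`. -/
lemma dQ' (r : Fin N × Fin N × Fin N) :
    M 1 (colM N r 2) = 0 ∧ M 0 (colM N r 2) = M 0 (colV N r.1) * M 0 (colV N r.2.1) := by
  have h1 := hv _ (mem_config_Qp_entry N Eadd Emul Eone r)
  have h2 := hv _ (mem_config_Qp_det N Eadd Emul Eone r)
  rw [det_entrySel_one M hI] at h1
  rw [det_KKK M] at h2
  obtain ⟨r0, r1⟩ := dR hI hF hd hv r
  have r2 : M 2 (colM N r 1) = 1 := hd (Sum.inr (Sum.inr (Sum.inr (r, 1))))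
  have v1 : M 1 (colV N r.1) = 1 := hd (Sum.inr (Sum.inl r.1))
  have v2 := dV hI hv r.1
  have q2 : M 2 (colM N r 2) = 1 := hd (Sum.inr (Sum.inr (Sum.inr (r, 2))))
  have q1 : M 1 (colM N r 2) = 0 := by linear_combination -h1
  refine ⟨q1, ?_⟩
  rw [r0, r1, r2, v1, v2, q1, q2] at h2
  linear_combination h2

/-- Multiplication gadget, final incidence: `x_i · x_j = x_k` for `(i, j, k) ∈ Emul`. -/
lemma dMul (r : Fin N × Fin N × Fin N) (hr : r ∈ Emul) :
    M 0 (colV N r.1) * M 0 (colV N r.2.1) - M 0 (colV N r.2.2) = 0 := by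
  have h := hv _ (mem_config_mul_det N Eadd Emul Eone r hr)
  rw [det_KKK M] at h
  obtain ⟨x0, x1⟩ := dX hI hF hd hv
  have x2 : M 2 (colX N) = 1 := hd (Sum.inl 2)
  obtain ⟨q1, q0⟩ := dQ' hI hF hd hv r
  have q2 : M 2 (colM N r 2) = 1 := hd (Sum.inr (Sum.inr (Sum.inr (r, 2))))
  have v1 : M 1 (colV N r.2.2) = 1 := hd (Sum.inr (Sum.inl r.2.2))
  have v2 := dV hI hv r.2.2
  rw [x0, x1, x2, q0, q1, q2, v1, v2] at h
  linear_combination -h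

/-- Unit incidence: `x_i = 1` for `i ∈ Eone`. -/
lemma dOne (i : Fin N) (hi : i ∈ Eone) : M 0 (colV N i) - 1 = 0 := by
  have h := hv _ (mem_config_one_det N Eadd Emul Eone i hi)
  rw [det_e2_F M hI hF] at h
  have v1 : M 1 (colV N i) = 1 := hd (Sum.inr (Sum.inl i))
  linear_combination -h + v1

end Deduce

end NormEnc

open NormEnc in
/-- **Registered stub `stub_configDeductions`**: on a normalised configuration matrix satisfying the
imposed incidences, the values `x_k := M 0 V_k` satisfy every elementary relation of the presentation
(`x_i + x_j = x_k` on `Eadd`, `x_i x_j = x_k` on `Emul`, `x_i = 1` on `Eone`). [cite: LeeVakil2012, §3;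
Mnev1988] -/
theorem stub_configDeductions {R : Type} [CommRing R] {N : ℕ}
    {Eadd Emul : Finset (Fin N × Fin N × Fin N)} {Eone : Finset (Fin N)}
    {M : Matrix (Fin 3) (Fin 3 ⊕ (Unit ⊕ Kol N)) R}
    (hI : ∀ i j, M i (Sum.inl j) = (1 : Matrix (Fin 3) (Fin 3) R) i j)
    (hF : ∀ i, M i (Sum.inr (Sum.inl ())) = 1)
    (hd : ∀ c : Kol N, M (dRow N c) (Sum.inr (Sum.inr c)) = 1)
    (hv : ∀ u ∈ config N Eadd Emul Eone, (M.submatrix id u).det = 0) :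
    (∀ r ∈ Eadd, M 0 (colV N r.1) + M 0 (colV N r.2.1) - M 0 (colV N r.2.2) = 0) ∧
      (∀ r ∈ Emul, M 0 (colV N r.1) * M 0 (colV N r.2.1) - M 0 (colV N r.2.2) = 0) ∧
        (∀ i ∈ Eone, M 0 (colV N i) - 1 = 0) :=
  ⟨dAdd hI hF hd hv, dMul hI hF hd hv, dOne hI hF hd hv⟩

end Summit.ResolutionOfSingularities.ResolutionOfSingularities.Theorems.UniversalCells

end
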